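/-
Copyright (c) 2026 the pub-hodgecm-mathlib formalisation cell (harness21).  Prover seat hodgecm-mathlib-K2E4-p11 (g8): Track B «K2-LIT»,
#184♮ = hLiu418 = stmt-HodgeConjecture-24832; socket #42F′ FACE-A residue HOL-½′ (RULING M-158t (1)(b)(d), LEAD F0P6-plan (g14); desk K2E3-p14 (g8)):
the REMOVABLE-SINGULARITY PATCH at `s = ½`.  THEOREMS ONLY (no `def`, no `instance`, no `notation`, no named-fact hypothesis, no `sorry`).
-/
import Mathlib.Analysis.Complex.RemovableSingularity
import HarnessLib

/-!
# Crux `HLiu418`, socket #42F′, FACE-A residue HOL-½′ — `K2LiuResidueZeroRemovable`: A CONTINUATION VANISHING AT `½` DIVIDES BY `(s − ½)` HOLOMORPHICALLY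

Cell `hodgecm-mathlib`, crux item hLiu418 = `stmt-HodgeConjecture-24832`; squad K2 ∕ K2Liu (L1, LEAD F0P6-plan (g14)), road `K2_Liu`; RULING M-158t: FACE-A's residue of
record is HOL-½′ «for every twisted Siegel–Weil vector `x`, the family `E(s, g_x)` admits a continuation `Eg` holomorphic on `{0 < re s}` agreeing with the series on
`{n∕2 < re s}`», to be paid from socket #41's output `(P = {½}, Es)` — `Es` holomorphic on `{0 < re}`, `Es = (s − ½)·E` on `{n∕2 < re}` — and U1-glob stage 3's
vanishing `Es(½, ·) = 0`.  Lane `--supports stmt-HodgeConjecture-24832 --as helper` (count-neutral helper; closes no socket by itself).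

THE MATHEMATICS [Conway1978, IV §3 (removable singularities)], [Tan1999, §4 Prop. 4.8].  If `Es(·, h)` is holomorphic on the open half-plane `U = {0 < re}` and
`Es(½, h) = 0`, then `Eg(s, h) := dslope Es(·,h) ½ s` — the difference quotient `(Es(s,h) − Es(½,h))/(s − ½)` extended by the derivative at `½` — is holomorphic on `U`
(Mathlib `Complex.differentiableOn_dslope`, Riemann's removable singularity theorem) and equals `Es(s,h)/(s − ½) = E(s,h)` wherever `Es = (s − ½)·E` and `s ≠ ½`,
in particular on `{n∕2 < re s}` for `n ≥ 1`.
* §1 **`exists_continuation_of_eq_sub_half_mul`** (`heq` as `Es = (s − ½)·E`); §2 **`exists_continuation_of_eq_prod_singleton_mul`** (`heq` in socket #41's currency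
  `Es = (∏_{p ∈ {½}} (s − p))·E`).
HONEST LABEL.  Count-neutral helper; it retires nothing by itself: `HC_CM` is proved only modulo the 7 printed citations (2 remaining named inputs:
hLiu418 = `stmt-HodgeConjecture-24832`, h413 = `stmt-HodgeConjecture-24833`) until rung 0 closes.

## References
* [Conway1978] J. B. Conway, *Functions of One Complex Variable I* (1978), IV §3 (removable singularities).
* [Tan1999] V. Tan, *Poles of Siegel Eisenstein series on U(n,n)*, Canad. J. Math. 51 (1999), §4 Prop. 4.8.
-/

set_option autoImplicit false
set_option linter.dupNamespace false -- the mandated namespace repeats `HodgeConjecture.HodgeConjecture`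

noncomputable section

open Set Filter Topology

namespace Summit.HodgeConjecture.HodgeConjecture.Cruxes.HLiu418.K2LiuResidueZeroRemovable

variable {X : Type*}

/-! ## §1 Dividing a continuation that vanishes at `½` by `(s − ½)` -/

/-- **REMOVABLE SINGULARITY AT `½`.**  If `Es(·, h)` is holomorphic on `{0 < re}` with `Es(½, h) = 0` for every `h`, and `Es = (s − ½)·E` on `{n∕2 < re s}` (`n ≥ 1`), then
`Eg(s, h) := dslope Es(·, h) ½ s` is holomorphic on `{0 < re}` for every `h` and agrees with `E` on `{n∕2 < re s}` (Mathlib `Complex.differentiableOn_dslope`).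
[cite: Conway1978, IV §3] [cite: Tan1999, §4 Prop. 4.8] -/
theorem exists_continuation_of_eq_sub_half_mul {n : ℕ} (hn : 0 < n) (E Es : ℂ → X → ℂ)
    (hd : ∀ h, DifferentiableOn ℂ (fun s => Es s h) {s : ℂ | 0 < s.re}) (hz : ∀ h, Es (1 / 2) h = 0)
    (heq : ∀ (s : ℂ) (h : X), (n : ℝ) / 2 < s.re → Es s h = (s - 1 / 2) * E s h) :
    ∃ Eg : ℂ → X → ℂ, (∀ h, DifferentiableOn ℂ (fun s => Eg s h) {s : ℂ | 0 < s.re}) ∧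
      ∀ (s : ℂ) (h : X), (n : ℝ) / 2 < s.re → Eg s h = E s h := by
  have hU : {s : ℂ | 0 < s.re} ∈ 𝓝 ((1 / 2 : ℂ)) := by
    refine (isOpen_lt continuous_const Complex.continuous_re).mem_nhds ?_
    show (0 : ℝ) < ((1 / 2 : ℂ)).re
    norm_num
  refine ⟨fun s h => dslope (fun s => Es s h) (1 / 2) s, fun h => (Complex.differentiableOn_dslope hU).2 (hd h), fun s h hs => ?_⟩
  have hn1 : (1 : ℝ) ≤ n := by exact_mod_cast hn
  have hs' : (1 : ℝ) / 2 < s.re := by linarith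
  have hne : s ≠ 1 / 2 := by
    rintro rfl
    norm_num at hs'
  have hsub : s - 1 / 2 ≠ 0 := sub_ne_zero.2 hne
  show dslope (fun s => Es s h) (1 / 2) s = E s h
  rw [dslope_of_ne _ hne, slope_def_field, hz, sub_zero, heq s h hs, mul_div_cancel_left₀ _ hsub]

/-! ## §2 The same in socket #41's currency `Es = (∏_{p ∈ {½}} (s − p))·E` -/

/-- **HOL-½′ FROM SOCKET #41's OUTPUT AT `P = {½}` AND THE VANISHING AT `½`**: with `heq` written as #41's clause (iv), `Es s h = (∏ p ∈ {½}, (s − p)) · E s h` on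
`{n∕2 < re s}`, the same continuation `Eg` exists. [cite: Conway1978, IV §3] [cite: Tan1999, §4 Prop. 4.8] -/
theorem exists_continuation_of_eq_prod_singleton_mul {n : ℕ} (hn : 0 < n) (E Es : ℂ → X → ℂ)
    (hd : ∀ h, DifferentiableOn ℂ (fun s => Es s h) {s : ℂ | 0 < s.re}) (hz : ∀ h, Es (1 / 2) h = 0)
    (heq : ∀ (s : ℂ) (h : X), (n : ℝ) / 2 < s.re → Es s h = (∏ p ∈ ({(1 / 2 : ℂ)} : Finset ℂ), (s - p)) * E s h) :
    ∃ Eg : ℂ → X → ℂ, (∀ h, DifferentiableOn ℂ (fun s => Eg s h) {s : ℂ | 0 < s.re}) ∧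
      ∀ (s : ℂ) (h : X), (n : ℝ) / 2 < s.re → Eg s h = E s h :=
  exists_continuation_of_eq_sub_half_mul hn E Es hd hz fun s h hs => by rw [heq s h hs, Finset.prod_singleton]

end Summit.HodgeConjecture.HodgeConjecture.Cruxes.HLiu418.K2LiuResidueZeroRemovable

end
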